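import Summits.ABC.ABC.Theses.PadicPrimesKummerThird
import HarnessLib

set_option linter.dupNamespace false

/-!
# Route PadicPrimesKummerThird (rung F-A1 = Stewart–Yu 2001, `log c ≪ rad^{1/3}(log rad)^3`):
# the `Assembly` (stmt-ABC-19661)

`Summits/ABC/ABC/Theorems/PadicPrimesKummerThirdClosers.lean` — cell `abc-stewartyu`, seat p3 (g4).
The route (planner g6 / plan-m3, born 2026-08-26T14:16:44Z) closes the rung leaf
`Literature.NumberTheory.DiophantineGeometry.stewart_yu` (≡ `Literature.Barriers.ABC.BakerMethodBounds`
≡ `BakerShapeBound (1/3) 3`) from the two prime-class `p`-adic texts `Y07Odd` / `Y07Two` through the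
door `KummerDoor`; its Assembly item is the route's own deciding theorem `closes`. [folklore] composition.
WHAT THIS IS NOT: the two engine cruxes `Y07Odd` / `Y07Two` are untouched; no summit credit (class rung).
-/

namespace Summit.ABC.ABC.Theorems

/-- **Item stmt-ABC-19661 `Assembly`** of route `PadicPrimesKummerThird`: `Y07Odd → Y07Two →
KummerDoor → stewart_yu`, by the route's `closes` (`BakerMethodBounds_iff_stewartYu`). [folklore] -/
theorem padicPrimesKummerThird_assembly_proof :
    Summit.ABC.ABC.Theses.PadicPrimesKummerThird.Assembly :=
  fun h₁ h₂ hd => Summit.ABC.ABC.Theses.PadicPrimesKummerThird.closes h₁ h₂ hd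

end Summit.ABC.ABC.Theorems
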